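import Mathlib
import Literature.NumberTheory.Automorphic.AutomorphicTwistHecke
import Literature.NumberTheory.Automorphic.GLOneOfHeckeCharacterBJ
import Literature.NumberTheory.Automorphic.GLOneArchParameterOfAlgebraicCharacter
import Literature.NumberTheory.Automorphic.ClozelAlgebraicityRankOneProofs
import Literature.NumberTheory.Automorphic.GLnAdelicStructureProofs
import Summits.Langlands.Langlands.Theorems.IrreducibilityBySelfDualityRegularTwistCMTwistRealisation
import HarnessLib

/-!
# Twisting an `L`-algebraic cuspidal representation of `GL_n(𝔸_K)` by an ALGEBRAIC Hecke
# character: infinity type, `L`-algebraicity, Satake parameters, and the "untwist in sum form"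

Helper file of the line `split-ramified-prime-sqrt6` for the crux
`Summit.Langlands.Langlands.Theses.PicardMuOrdinary.IrregularClassicality` (stmt-Langlands-13758),
serving its last stub (`stub_irregularDescentUntwist`: the untwist `π'_K ↦ π'_K ⊗ ψ⁻¹` of a
cuspidal `L`-algebraic `π'_K` on `GL₃(𝔸_K)`, `K = ℚ(ω)`, by the inverse of the CM Größencharakter
`ψ` of conductor `(3)`, an algebraic Hecke character of INFINITE order).  Everything here is
proved for a general number field `K`, rank `n ≥ 1` and an arbitrary algebraic Hecke character
`θ` (Weil's type `A₀`: `θ((x,1)) = ∏_w ι_w(x_w)^{-p_w} \overline{ι_w(x_w)}^{-q_w}` near `1`):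

* `hasInfinityType_twist_hecke` — **the infinity type of `π ⊗ (θ ∘ det)`**: if the Borel–Jacquet
  datum `π = W / W'` has infinity type `T` and `θ` has infinity type `(p, q)`, the twisted datum
  `π' = W·c / W'·c`, `c = θ ∘ det` (`exists_cuspidalAutomorphicRepData_twist_hecke`) has the
  infinity type `σ ↦ {(a - n_σ, b - n_σ̄) : (a, b) ∈ T σ}`, `n_σ = embExponent p q σ` the exponent
  of the embedding `σ` in the type of `θ`.  Proof: the `GL₁` datum `π_θ = ℂ·(θ∘det)/⊥`
  (`exists_automorphicRepData_detTwist_glOne`) has Hecke character `θ`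
  (`heckeCharacter_of_eq_span_detTwist_glOne`) and archimedean parameter `σ ↦ {-n_σ}`
  (`hasArchParameter_of_hasInfinityType_heckeCharacter_glOne`, Clozel 1990 §3.3 for `n = 1`), and
  the archimedean parameter of the twist of `π` by a `GL₁` datum is the shifted one
  (`RegularTwistCM.AutomorphicRepData.hasArchParameter_twist_glOne`, Borel–Jacquet 1979, 5.7).
* `IsLAlgebraic.twist_hecke`, `exists_twist_isLAlgebraic_hasSatakeParamAt` — hence **the twist
  of an `L`-algebraic `π` by an algebraic `θ` is `L`-algebraic** (the shifts `n_σ` are integers),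
  and for cuspidal `π` there is a cuspidal `L`-algebraic `π'` with Satake parameters
  `θ(ϖ_v) · t_{π,v}` at almost every `v`
  (`AutomorphicRepData.eventually_hasSatakeParamAt_of_map_mulChar_detTwist`, Arthur–Clozel 1989,
  Ch. 3 p. 172).
* `exists_untwist_sum_eq` — **the untwist in sum form**: if `Σ t_{π,v} = a(v) · θ(ϖ_v)` for
  almost all `v`, then some cuspidal `L`-algebraic `π'` (namely `π ⊗ (θ⁻¹ ∘ det)`) has
  `Σ t_{π',v} = a(v)` for almost all `v`.

References: A. Borel, H. Jacquet, Corvallis 1979, part 1, §4.6, 5.7; L. Clozel, *Motifs et formes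
automorphes* (1990), §1.1, §3.3; K. Buzzard, T. Gee (2014), Def. 3.1.1, §3.1; J. Arthur,
L. Clozel, Ann. of Math. Stud. 120 (1989), Ch. 3, proof of Thm. 3.1 (p. 172); A. Weil (1956), §1.
-/

open scoped Classical
open NumberField Filter IsDedekindDomain
open Literature.NumberTheory.Automorphic Literature.NumberTheory.GaloisRepresentations

set_option linter.dupNamespace false -- project-wide option; `Summit.Langlands.Langlands` is the mandated namespace

noncomputable section

namespace Summit.Langlands.Langlands.Theorems.IrregularClassicality.SplitRamifiedPrimeSqrt6

variable {n : ℕ} {K : Type} [Field K] [NumberField K] {hcpt : isCompact_glFiniteIntegralLevel n K}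

/-! ## Algebraic Hecke characters: inverse, and the infinity type -/

/-- The inverse of an algebraic Hecke character is algebraic, of the opposite type `(-p, -q)` on
the same neighbourhood of `1` (Weil 1956, §1; Serre 1968, Ch. II §2.4). -/
theorem heckeCharacter_hasInfinityType_inv {θ : HeckeCharacter K} {p q : InfinitePlace K → ℤ}
    (h : θ.HasInfinityType p q) : θ⁻¹.HasInfinityType (-p) (-q) := by
  -- adapted from `HeckeCharacter.IsAlgebraic.inv` (GaloisRepresentations/WeakAbelianDirectSummandTwistProofs)
  obtain ⟨U, hU, h⟩ := h
  refine ⟨U, hU, fun x hx => ?_⟩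
  rw [HeckeCharacter.inv_apply, Units.val_inv_eq_inv_val, h x hx, HeckeCharacter.archFactor_apply,
    HeckeCharacter.archFactor_apply, ← Finset.prod_inv_distrib]
  refine Finset.prod_congr rfl fun w _ => ?_
  simp only [Pi.neg_apply, neg_neg, mul_inv, ← zpow_neg]

/-- The value of `θ⁻¹` at a uniformizer is the inverse of the value of `θ`. -/
theorem heckeCharacter_valueAtUniformizer_inv (θ : HeckeCharacter K) (v : HeightOneSpectrum (𝓞 K)) :
    θ⁻¹.valueAtUniformizer v = (θ.valueAtUniformizer v)⁻¹ := by
  simp only [HeckeCharacter.valueAtUniformizer, HeckeCharacter.localComponent_apply,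
    HeckeCharacter.inv_apply, Units.val_inv_eq_inv_val]

/-! ## The infinity type of the twist `π ⊗ (θ ∘ det)` -/

/-- **The infinity type of the twist of a Borel–Jacquet datum by an algebraic Hecke character.**
If `π = W / W'` on `GL_n(𝔸_K)` has infinity type `T` and `θ` has infinity type `(p, q)`, then the
twisted datum `π'` (`π'.W = (θ∘det)·W`, `π'.W' = (θ∘det)·W'`) has the infinity type
`σ ↦ {(a - n_σ, b - n_σ̄) : (a,b) ∈ T σ}` with `n_σ = embExponent p q σ`; in particular its
archimedean parameter is `σ ↦ {a - n_σ}`.  (Borel–Jacquet 1979, 5.7; Clozel 1990, §3.3;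
Buzzard–Gee 2014, §3.1.) -/
theorem hasInfinityType_twist_hecke {θ : HeckeCharacter K} {p q : InfinitePlace K → ℤ}
    (hθ : θ.HasInfinityType p q) {π π' : AutomorphicRepData (AutomorphyDatum.gl n K hcpt)}
    (hW : π'.W = π.W.map (mulChar (detTwist n θ)))
    (hW' : π'.W' = π.W'.map (mulChar (detTwist n θ)))
    {T : InfinityType K n} (hT : π.HasInfinityType T) :
    ∃ T' : InfinityType K n, π'.HasInfinityType T' ∧
      (∀ σ : K →+* ℂ, T' σ = (T σ).map fun w => ⟨w.a - HeckeCharacter.embExponent p q σ,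
          w.b - HeckeCharacter.embExponent p q (ComplexEmbedding.conjugate σ),
          w.exists_int_sub.elim fun m hm => ⟨m - HeckeCharacter.embExponent p q σ +
            HeckeCharacter.embExponent p q (ComplexEmbedding.conjugate σ), by
              push_cast; rw [← hm]; ring⟩⟩) := by
  -- the `GL₁` datum of `θ`, its Hecke character and its archimedean parameter
  obtain ⟨π₁, hW₁, hW₁'⟩ :=
    exists_automorphicRepData_detTwist_glOne (isCompact_glFiniteIntegralLevel_holds 1 K) θ
  have hχ := AutomorphicRepData.heckeCharacter_of_eq_span_detTwist_glOne hW₁ hW₁'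
  have hp := π₁.hasArchParameter_of_hasInfinityType_heckeCharacter_glOne hχ hθ
  -- the archimedean parameter of the twist
  have hP := RegularTwistCM.AutomorphicRepData.hasArchParameter_twist_glOne π₁ hχ hp hW hW' hT.2
  refine ⟨_, ⟨⟨fun σ => ?_, fun σ => ?_⟩, ?_⟩, fun σ => rfl⟩
  · -- `n` weights at every embedding
    rw [Multiset.card_map, hT.1.1 σ]
  · -- compatibility with complex conjugation
    rw [hT.1.2 σ, Multiset.map_map, Multiset.map_map]
    refine Multiset.map_congr rfl fun w _ => ?_
    ext
    · rfl
    · simp only [Function.comp_apply, ArchWeight.swap_b]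
      rw [show ComplexEmbedding.conjugate (ComplexEmbedding.conjugate σ) = σ from
        ComplexEmbedding.involutive_conjugate K σ]
  · -- the archimedean parameter
    convert hP using 1
    funext σ
    simp only [Multiset.map_map, Function.comp_apply, sub_eq_add_neg]

/-- **Twisting by an algebraic Hecke character preserves `L`-algebraicity** (the shifts `n_σ`
are integers; Buzzard–Gee 2014, Def. 3.1.1). -/
theorem isLAlgebraic_twist_hecke {θ : HeckeCharacter K} (hθ : θ.IsAlgebraic)
    {π π' : AutomorphicRepData (AutomorphyDatum.gl n K hcpt)}
    (hW : π'.W = π.W.map (mulChar (detTwist n θ)))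
    (hW' : π'.W' = π.W'.map (mulChar (detTwist n θ))) (hπ : π.IsLAlgebraic) :
    π'.IsLAlgebraic := by
  obtain ⟨p, q, hθ⟩ := (HeckeCharacter.isAlgebraic_iff_exists_hasInfinityType θ).mp hθ
  obtain ⟨T, hT, hTL⟩ := hπ
  obtain ⟨T', hT', hTT'⟩ := hasInfinityType_twist_hecke hθ hW hW' hT
  refine ⟨T', hT', fun σ w hw => ?_⟩
  rw [hTT' σ] at hw
  obtain ⟨w₀, hw₀, rfl⟩ := Multiset.mem_map.mp hw
  obtain ⟨k, l, hk, hl⟩ := hTL σ w₀ hw₀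
  exact ⟨k - HeckeCharacter.embExponent p q σ,
    l - HeckeCharacter.embExponent p q (ComplexEmbedding.conjugate σ),
    by push_cast; rw [hk], by push_cast; rw [hl]⟩

/-- **The twist of a cuspidal `L`-algebraic `π` on `GL_n(𝔸_K)` (`n ≥ 1`) by an algebraic Hecke
character `θ` is cuspidal and `L`-algebraic, with Satake parameters `θ(ϖ_v) · t_{π,v}` at almost
every finite place** (Borel–Jacquet 1979, 5.7; Arthur–Clozel 1989, Ch. 3 p. 172; Buzzard–Gee 2014,
§3.1). -/
theorem exists_twist_isLAlgebraic_hasSatakeParamAt [NeZero n] (π : CuspidalAutomorphicRepData n K hcpt)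
    (hπ : π.1.IsLAlgebraic) {θ : HeckeCharacter K} (hθ : θ.IsAlgebraic) :
    ∃ π' : CuspidalAutomorphicRepData n K hcpt, π'.1.IsLAlgebraic ∧
      ∀ᶠ v : HeightOneSpectrum (𝓞 K) in cofinite, ∀ α : Multiset ℂ,
        π.1.HasSatakeParamAt v α → π'.1.HasSatakeParamAt v (α.map (θ.valueAtUniformizer v * ·)) := by
  obtain ⟨π', hW, hW'⟩ := exists_cuspidalAutomorphicRepData_twist_hecke θ π
  exact ⟨π', isLAlgebraic_twist_hecke hθ hW hW' hπ,
    AutomorphicRepData.eventually_hasSatakeParamAt_of_map_mulChar_detTwist θ hW hW'⟩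

/-- **The untwist in sum form.**  Let `π` be cuspidal `L`-algebraic on `GL_n(𝔸_K)` (`n ≥ 1`) and
`θ` an algebraic Hecke character; if for almost every `v` the Satake parameter of `π` at `v` has
sum `a(v) · θ(ϖ_v)`, then there is a cuspidal `L`-algebraic `π'` on `GL_n(𝔸_K)` — the twist
`π ⊗ (θ⁻¹ ∘ det)` — whose Satake parameter at almost every `v` has sum `a(v)` (the values
`θ(ϖ_v)` at unramified `v` are non-zero).  This is the shape in which the crux
`IrregularClassicality` consumes the untwist by the CM character `ψ` (`ψ(ϖ_𝔭) = e(ϖ_𝔭)`). -/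
theorem exists_untwist_sum_eq [NeZero n] (π : CuspidalAutomorphicRepData n K hcpt)
    (hπ : π.1.IsLAlgebraic) {θ : HeckeCharacter K} (hθ : θ.IsAlgebraic)
    (a : HeightOneSpectrum (𝓞 K) → ℂ)
    (h0 : ∀ᶠ v : HeightOneSpectrum (𝓞 K) in cofinite, θ.valueAtUniformizer v ≠ 0)
    (h : ∀ᶠ v : HeightOneSpectrum (𝓞 K) in cofinite, ∃ α : Multiset ℂ,
      π.1.HasSatakeParamAt v α ∧ α.sum = a v * θ.valueAtUniformizer v) :
    ∃ π' : CuspidalAutomorphicRepData n K hcpt, π'.1.IsLAlgebraic ∧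
      ∀ᶠ v : HeightOneSpectrum (𝓞 K) in cofinite, ∃ α : Multiset ℂ,
        π'.1.HasSatakeParamAt v α ∧ α.sum = a v := by
  obtain ⟨p, q, hpq⟩ := (HeckeCharacter.isAlgebraic_iff_exists_hasInfinityType θ).mp hθ
  obtain ⟨π', hL, hS⟩ := exists_twist_isLAlgebraic_hasSatakeParamAt π hπ
    ((HeckeCharacter.isAlgebraic_iff_exists_hasInfinityType θ⁻¹).mpr
      ⟨-p, -q, heckeCharacter_hasInfinityType_inv hpq⟩)
  refine ⟨π', hL, ?_⟩
  filter_upwards [hS, h0, h] with v hv hv0 ⟨α, hα, hsum⟩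
  refine ⟨_, hv α hα, ?_⟩
  rw [Multiset.sum_map_mul_left, Multiset.map_id', hsum, heckeCharacter_valueAtUniformizer_inv,
    mul_comm (a v), ← mul_assoc, inv_mul_cancel₀ hv0, one_mul]

/-- **Registered form of the untwist in sum form** (helper stub `stub_algebraicHeckeUntwist` of
the line `split-ramified-prime-sqrt6`, all binders explicit): for `π` cuspidal `L`-algebraic on
`GL_n(𝔸_K)` (`n ≥ 1`), an algebraic Hecke character `θ` with `θ(ϖ_v) ≠ 0` a.e., and
`Σ t_{π,v} = a(v) θ(ϖ_v)` a.e., some cuspidal `L`-algebraic `π'` has `Σ t_{π',v} = a(v)` a.e.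
(`exists_untwist_sum_eq`). -/
theorem stub_algebraicHeckeUntwist :
    ∀ (n : ℕ) (K : Type) [Field K] [NumberField K] (hcpt : isCompact_glFiniteIntegralLevel n K)
      [NeZero n] (π : CuspidalAutomorphicRepData n K hcpt) (θ : HeckeCharacter K)
      (a : HeightOneSpectrum (𝓞 K) → ℂ), π.1.IsLAlgebraic → θ.IsAlgebraic →
      (∀ᶠ v : HeightOneSpectrum (𝓞 K) in Filter.cofinite, θ.valueAtUniformizer v ≠ 0) →
      (∀ᶠ v : HeightOneSpectrum (𝓞 K) in Filter.cofinite, ∃ α : Multiset ℂ,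
        π.1.HasSatakeParamAt v α ∧ α.sum = a v * θ.valueAtUniformizer v) →
      ∃ π' : CuspidalAutomorphicRepData n K hcpt, π'.1.IsLAlgebraic ∧
        ∀ᶠ v : HeightOneSpectrum (𝓞 K) in Filter.cofinite, ∃ α : Multiset ℂ,
          π'.1.HasSatakeParamAt v α ∧ α.sum = a v :=
  fun _ _ _ _ _ _ π _ a hπ hθ h0 h => exists_untwist_sum_eq π hπ hθ a h0 h

end Summit.Langlands.Langlands.Theorems.IrregularClassicality.SplitRamifiedPrimeSqrt6

end
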